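import Summits.ValiantsHypothesis.ValiantsHypothesis.Theses.ContractivityPrice
import Summits.ValiantsHypothesis.ValiantsHypothesis.Theorems.HubHub
import Literature.Computability.AlgebraicComplexity.ValiantConjectureProofs
import Literature.Computability.AlgebraicComplexity.DeterminantalComplexityProofs
import Literature.Computability.AlgebraicComplexity.VPDeterminantalQPProofs

/-!
# ValiantsHypothesis / ContractivityPrice — assembly

Settles item `stmt-ValiantsHypothesis-10589` (rank-1 assembly of route `ContractivityPrice`):
`PriceOfContractivity → ContractiveHardness → StabilisedPerZeroFree → StabilisedPerDetRepr →
QpComposition → ValiantsHypothesis`.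

Pure bookkeeping, following the route's deciding theorem.  Suppose the permanent family were a
`VP` family.  Bürgisser–Clausen–Shokrollahi 1997, Cor. (21.40) (in tree, proved:
`Literature.Computability.AlgebraicComplexity.isQPBounded_determinantalComplexity_of_isVPFamily_holds`)
gives `c` with `dc(per_n) ≤ 2^((log₂ n + c)^c)` for all `n`; `PriceOfContractivity` gives the
price exponent `d`; `QpComposition c d` gives `c'`; `ContractiveHardness c'` gives an `n` at which
no contractive realization of `Q_n = per_n(I + z/(4n))` of size `≤ 2^((log₂ n + c')^c')` exists.
But `hasDetRepr_determinantalComplexity_holds` and `StabilisedPerDetRepr` give an affine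
determinantal representation of `Q_n` of size `dc(per_n)`, `StabilisedPerZeroFree` gives
zero-freeness on the closed polydisc of radius `2`, so `PriceOfContractivity` (with `N = n²`
variables) yields a contractive realization of size `≤ 2^((log₂(dc(per_n) + n²) + d)^d) ≤
2^((log₂ n + c')^c')` — contradiction.  Hence `¬ IsVPFamily (fun n => perPoly (Fin n) ℂ)`, and the
hub lemma `Summit.ValiantsHypothesis.Hub.valiantsHypothesis_of_not_isVPFamily_per`
(Theorems/HubHub.lean) with the proved renaming bridge `mem_VP_ofFintype_iff_holds` and Valiant's
`perFamily_mem_VNP_holds ℂ` gives `ValiantsHypothesis` (`VP ℂ ≠ VNP ℂ`).  No named-fact hypothesis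
remains: the theorem is unconditional.
-/

namespace Summit.ValiantsHypothesis.Theorems.ContractivityPrice

open Literature.Computability.AlgebraicComplexity
open Summit.ValiantsHypothesis.ValiantsHypothesis.Theses.ContractivityPrice

/-- The five route items of `ContractivityPrice` force `per ∉ VP_ℂ` (as
`¬ IsVPFamily (fun n => perPoly (Fin n) ℂ)`): were the permanent a `VP` family, BCS97 Cor. (21.40)
(`isQPBounded_determinantalComplexity_of_isVPFamily_holds`) bounds `dc(per_n)` quasi-polynomially,
`StabilisedPerDetRepr` + `StabilisedPerZeroFree` + `PriceOfContractivity` turn that into a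
quasi-polynomial contractive realization of `Q_n = per_n(I + z/(4n))` (exponent bookkeeping by
`QpComposition`), and `ContractiveHardness` forbids it. [folklore] -/
theorem not_isVPFamily_per_of_items (h₁ : PriceOfContractivity) (h₂ : ContractiveHardness)
    (h₃ : StabilisedPerZeroFree) (h₄ : StabilisedPerDetRepr) (h₅ : QpComposition) :
    ¬ IsVPFamily (fun n => perPoly (Fin n) ℂ) := by
  intro hVP
  obtain ⟨c, hc⟩ := isQPBounded_determinantalComplexity_of_isVPFamily_holds _ hVP
  obtain ⟨d, hd⟩ := h₁
  obtain ⟨c', hc'⟩ := h₅ c d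
  obtain ⟨n, hn⟩ := h₂ c'
  have hrep := h₄ n _ (hasDetRepr_determinantalComplexity_holds (perPoly (Fin n) ℂ))
  obtain ⟨R, hR, K, κ, hK, hQ⟩ := hd (n ^ 2) _ _ (by simp [sq]) hrep (h₃ n)
  exact hn R (hR.trans (hc' n _ _ (hc n) le_rfl)) _ K κ hK hQ

/-- Settles `stmt-ValiantsHypothesis-10589` (assembly of route `ContractivityPrice`):
`PriceOfContractivity → ContractiveHardness → StabilisedPerZeroFree → StabilisedPerDetRepr →
QpComposition → ValiantsHypothesis`.  Proof: `not_isVPFamily_per_of_items` gives `per ∉ VP_ℂ`;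
the hub lemma `valiantsHypothesis_of_not_isVPFamily_per` with the proved renaming bridge
`mem_VP_ofFintype_iff_holds` (Bürgisser 2000, Rem. 2.2) and Valiant's `perFamily_mem_VNP_holds ℂ`
(Valiant 1979; Bürgisser 2000, Thm. 2.10) concludes `VP ℂ ≠ VNP ℂ`. [folklore] -/
theorem Assembly_proof :
    Summit.ValiantsHypothesis.ValiantsHypothesis.Theses.ContractivityPrice.Assembly := by
  unfold Summit.ValiantsHypothesis.ValiantsHypothesis.Theses.ContractivityPrice.Assembly
  intro h₁ h₂ h₃ h₄ h₅
  exact Summit.ValiantsHypothesis.Hub.valiantsHypothesis_of_not_isVPFamily_per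
    (not_isVPFamily_per_of_items h₁ h₂ h₃ h₄ h₅) (mem_VP_ofFintype_iff_holds _)
    (perFamily_mem_VNP_holds ℂ)

end Summit.ValiantsHypothesis.Theorems.ContractivityPrice
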